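import Mathlib
import HarnessLib
import Summits.AtomisticToContinuum.FouriersLaw.Theses.JunctionLocality
import Summits.AtomisticToContinuum.FouriersLaw.Theorems.JunctionLocalityConductanceLowerBoundStubRowSum
import Summits.AtomisticToContinuum.FouriersLaw.Theorems.JunctionLocalitySuperadditiveResistanceKuboDirichlet
import Summits.AtomisticToContinuum.FouriersLaw.Theorems.JunctionLocalitySuperadditiveResistanceStubPlainForwardField
import Summits.AtomisticToContinuum.FouriersLaw.Theorems.JunctionLocalitySuperadditiveResistanceStubDeviceForwardFieldsAux5
import Literature.MathematicalPhysics.KineticTheory.PhaseSpacePoisson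
import Literature.MathematicalPhysics.KineticTheory.ChainReflection
import Literature.MathematicalPhysics.KineticTheory.VelocityFlipNoise

/-!
# Far-contact Fisher square of the plain chain's forward field (stub `stub_fisherSquare` of line `ForecastSensitivitySketch`, crux stmt-AtomisticToContinuum-11749)

For the pinned anharmonic chain `pinnedChain ω₂ lam β γ` (all parameters `> 0`), `T > 0`, `L ≥ 2` and every
classical forward field of the LEFT bath — `g ∈ C² ∩ L²(μ_T)`, mean zero, `L_{T,T} g = −(p_0² − T)` pointwise,
`μ_T = gibbsMeasure L T` — the FAR-CONTACT FISHER SQUARE holds: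
`⟨g, p_{L−1}² − T⟩_{μ_T} = 2 γ T ‖∂_{p_{L−1}} g‖²_{L²(μ_T)}` (`stub_fisherSquare`).

Proof (every input landed in the tree; nothing taken as a named fact). Write `k_b = p_b² − T`, `R` the site
reflection `i ↦ L−1−i` of phase space, `a = ∂_{p_{L−1}} g`, `b = (∂_{p_0} g) ∘ R`.
* (R) `R` preserves `μ_T` (`measurePreserving_siteReflection_gibbsMeasure`: the FPU potential is even,
  `hamiltonian_siteReflection`, and a coordinate permutation preserves Liouville measure), `g ∘ R` is the RIGHT
  bath's forward field (`generator_comp_siteReflection`: `L_{T,T}(g∘R) = −k_{L−1}`), and ENERGY CONSERVATION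
  `L_{T,T} H = −γ(k_0 + k_{L−1})` (`liouvilleOp_hamiltonian`, `bathOp_bathWeight_hamiltonian`) makes
  `γ(g + g∘R) − (H − ⟨H⟩)` a mean-zero `C² ∩ L²(μ_T)` solution of `L_{T,T} w = 0`, hence zero by the tree's
  `L²(μ_T)`-Liouville theorem `eq_zero_of_liouville_pinnedChain`; differentiating along `p_{L−1}`
  (`partialP_comp_siteReflection`): `γ(a + b) = p_{L−1}` pointwise.
* (P) Gaussian projection `⟨g, k_j⟩ = T⟨∂_{p_j} g, p_j⟩` at `j = 0, L−1` (`integral_mul_sq_sub_gibbsMeasure`;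
  `∂_{p_b} g ∈ L²(μ_T)` by the finite entropy production of forward fields, `Kubo.memLp_partialP`) and the
  change of variables `R`: `T⟨a, p_{L−1}⟩ = ⟨g, k_{L−1}⟩`, `T⟨b, p_{L−1}⟩ = T⟨∂_{p_0}g, p_0⟩ = ⟨g, k_0⟩`,
  `‖b‖ = ‖∂_{p_0} g‖`. Pairing `γ(a + b) = p_{L−1}` with `a` and with `b` and subtracting:
  `γT(‖a‖² − ‖∂_{p_0}g‖²) = ⟨g, k_{L−1}⟩ − ⟨g, k_0⟩`.
* (D) the Dirichlet (carré du champ) identity `⟨g, k_0⟩ = γT(‖∂_{p_0}g‖² + ‖a‖²)`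
  (`integral_mul_source_eq_dirichlet'`: the `n → ∞` limit of `Kubo.dirichlet_level`). Adding:
  `⟨g, k_{L−1}⟩ = 2γT‖a‖²`.

References: Eckmann–Pillet–Rey-Bellet 1999 §3 (energy balance, entropy production of the open chain);
Bonetto–Lebowitz–Rey-Bellet 2000 §5 (the symmetric two-bath set-up); folklore.
-/

noncomputable section

open MeasureTheory Filter Topology
open scoped ContDiff
open Literature.MathematicalPhysics.KineticTheory.HeatConduction
open Summit.AtomisticToContinuum.FouriersLaw.Theorems.SuperadditiveResistance.DeviceLiouville
  (kin kin_eq_sq continuous_kin liouvilleOp bathOp generator_eq_liouvilleOp_add eq_zero_of_liouville_pinnedChain)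
open Summit.AtomisticToContinuum.FouriersLaw.Theorems.SuperadditiveResistance.Kubo
  (memLp_partialP chi dirichlet_level tendsto_integral_chi_mul tendsto_integral_partialP_chi_mul
    integrable_mul_mul_gibbsDensity integrable_sq_mul_gibbsDensity)
open Summit.AtomisticToContinuum.FouriersLaw.Cruxes.SuperadditiveResistance.FloatingProbeBypassLaplacian
  (pinnedChain_memLp_two_snd_sq integral_mul_sq_sub_gibbsMeasure generator_sub_const partialP_sub_const'
    liouvilleOp_add' liouvilleOp_const_mul bathOp_add' bathOp_const_mul)
open Summit.AtomisticToContinuum.FouriersLaw.Cruxes.SuperadditiveResistance.InsertionToolbox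
  (pinnedChain_memLp_two_of_abs_le)

namespace Summit.AtomisticToContinuum.FouriersLaw.Cruxes.ConductanceLowerBound.ForecastSensitivity

/-! ## The site reflection preserves the Gibbs measure -/

section Reflection

/-- The site reflection `(q, p) ↦ (q ∘ rev, p ∘ rev)` preserves Lebesgue (Liouville) measure on phase space
(each factor is the coordinate permutation `piCongrLeft rev`). [folklore] -/
theorem measurePreserving_siteReflection_volume (L : ℕ) :
    MeasurePreserving (siteReflection L) (volume : Measure (PhaseSpace L)) volume := by
  have h := (volume_measurePreserving_piCongrLeft (fun _ : Fin L => ℝ) Fin.revPerm).symm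
    (MeasurableEquiv.piCongrLeft (fun _ : Fin L => ℝ) Fin.revPerm)
  have hfun : ⇑(MeasurableEquiv.piCongrLeft (fun _ : Fin L => ℝ) Fin.revPerm).symm =
      fun q : Fin L → ℝ => q ∘ Fin.rev := by
    funext q i
    rfl
  rw [hfun] at h
  have hR : siteReflection L =
      Prod.map (fun q : Fin L → ℝ => q ∘ Fin.rev) (fun p : Fin L → ℝ => p ∘ Fin.rev) := by
    funext x; rfl
  rw [hR]
  exact h.prod h

/-- **The site reflection preserves the Gibbs measure** of every chain with an even interaction
(the energy is reflection invariant and Liouville measure is permutation invariant). [folklore] -/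
theorem measurePreserving_siteReflection_gibbsMeasure (P : OscillatorChain) (hV : ∀ r, P.V (-r) = P.V r)
    (L : ℕ) (T : ℝ) :
    MeasurePreserving (siteReflectionEquiv L) (P.gibbsMeasure L T) (P.gibbsMeasure L T) := by
  rw [P.gibbsMeasure_eq]
  exact measurePreserving_tilted_of_invariant (siteReflectionEquiv L)
    (measurePreserving_siteReflection_volume L) fun x => by
      rw [siteReflectionEquiv_apply, P.hamiltonian_siteReflection hV]

/-- The reflection exchanges the two contact kinetic observables: `p_0² ∘ R = p_{L−1}²`. [folklore] -/
theorem kin_zero_siteReflection {L : ℕ} (hL : 0 < L) (x : PhaseSpace L) :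
    kin L 0 (siteReflection L x) = kin L (L - 1) x := by
  have hL1 : L - 1 < L := by omega
  have h : Fin.rev (⟨0, hL⟩ : Fin L) = ⟨L - 1, hL1⟩ := Fin.ext (by simp only [Fin.val_rev])
  rw [kin_eq_sq hL, kin_eq_sq hL1, siteReflection_snd, h]

end Reflection

/-! ## The two bath weights -/

section Weights

variable {L : ℕ}

/-- `Σ_i ([i=0]+[i=L−1]) a_i = a_{b₀} + a_{b₁}` for the two bath sites `b₀ = 0`, `b₁ = L − 1`
(adapted from `Corrector.sum_bathWeight_mul`). [folklore] -/
theorem sum_bathWeight_mul' (a : Fin L → ℝ) {b₀ b₁ : Fin L} (hb₀ : b₀.val = 0) (hb₁ : b₁.val = L - 1) :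
    ∑ i : Fin L, OscillatorChain.bathWeight L i * a i = a b₀ + a b₁ := by
  simp only [OscillatorChain.bathWeight, add_mul, Finset.sum_add_distrib, ite_mul, one_mul, zero_mul]
  congr 1
  · rw [Finset.sum_eq_single_of_mem b₀ (Finset.mem_univ _)]
    · rw [if_pos hb₀]
    · exact fun b _ hb => if_neg fun h => hb (Fin.ext (by omega))
  · rw [Finset.sum_eq_single_of_mem b₁ (Finset.mem_univ _)]
    · rw [if_pos hb₁]
    · exact fun b _ hb => if_neg fun h => hb (Fin.ext (by omega))

end Weights

/-! ## (D) The Dirichlet identity of a forward pair, cutoff removed -/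

section DirichletLimit

variable {ω₂ lam β γ : ℝ} {L : ℕ}

/-- **Carré du champ, cutoff removed.** For the pinned chain (`ω₂ > 0`, `lam, β ≥ 0`, `γ > 0`), `T > 0`, and a
classical solution `u ∈ C² ∩ L²(μ_T)` of `L_{T,T} u = −k` with a continuous `k ∈ L²(μ_T)`:
`∫ u k e^{−H/T} = γ T Σ_i ([i=0]+[i=L−1]) ∫ (∂_{p_i} u)² e^{−H/T}` — the `n → ∞` limit of `Kubo.dirichlet_level`
(`χ_n → 1`, the cutoff-gradient term vanishes by dominated convergence since `∂_{p_b} u ∈ L²(μ_T)` at the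
thermostatted sites, `Kubo.memLp_partialP`). (adapted from `Corrector.integral_mul_source_eq_dirichlet`) [folklore] -/
theorem integral_mul_source_eq_dirichlet' (hω : 0 < ω₂) (hl : 0 ≤ lam) (hβ : 0 ≤ β) (hγ : 0 < γ) {T : ℝ}
    (hT : 0 < T) {u k : PhaseSpace L → ℝ} (hu : ContDiff ℝ 2 u)
    (hu2 : MemLp u 2 ((pinnedChain ω₂ lam β γ).gibbsMeasure L T)) (hkc : Continuous k)
    (hk2 : MemLp k 2 ((pinnedChain ω₂ lam β γ).gibbsMeasure L T))
    (hpde : ∀ x, (pinnedChain ω₂ lam β γ).generator L T T u x = -k x) :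
    ∫ x, u x * k x * (pinnedChain ω₂ lam β γ).gibbsDensity L T x =
      γ * T * ∑ i : Fin L, OscillatorChain.bathWeight L i *
        ∫ x, partialP i u x ^ 2 * (pinnedChain ω₂ lam β γ).gibbsDensity L T x := by
  set P := pinnedChain ω₂ lam β γ with hP
  set B := OscillatorChain.bathWeight L with hB
  have hBnn : ∀ i, 0 ≤ B i := bathWeight_nonneg L
  have hpde' : ∀ x, 1 * liouvilleOp P L u x + γ * bathOp L B T u x = -k x := fun x => by
    rw [one_mul, ← hpde x, generator_eq_liouvilleOp_add]; rfl
  have hu1 : ContDiff ℝ 1 u := hu.of_le (by norm_cast)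
  have huc : Continuous u := hu.continuous
  have hduc : ∀ i, Continuous (partialP i u) := fun i => continuous_partialP hu1 one_ne_zero i
  -- the identity at cutoff level `n`
  have hlevel : ∀ n : ℕ, (∫ x, chi P L n x * u x * k x * P.gibbsDensity L T x) -
      γ * T * ∑ i, B i * ∫ x, u x * partialP i (chi P L n) x * partialP i u x * P.gibbsDensity L T x =
      γ * T * ∑ i, B i * ∫ x, chi P L n x * partialP i u x ^ 2 * P.gibbsDensity L T x :=
    fun n => (dirichlet_level hω hl hβ γ L hT B 1 γ hu hpde' n).symm
  -- finite entropy production at the weighted sites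
  have hdu2 : ∀ {i : Fin L}, 0 < B i → MemLp (partialP i u) 2 (P.gibbsMeasure L T) := fun {i} hi =>
    memLp_partialP hω hl hβ γ L hT B hBnn 1 hγ hu hu2 hk2 hpde' hi
  -- the source term converges
  have hukL1 : Integrable fun x => u x * k x * P.gibbsDensity L T x :=
    integrable_mul_mul_gibbsDensity hω hl hβ γ L hT hu2 hk2
  have hlim1 : Tendsto (fun n : ℕ => ∫ x, chi P L n x * u x * k x * P.gibbsDensity L T x) atTop
      (𝓝 (∫ x, u x * k x * P.gibbsDensity L T x)) := by
    refine (tendsto_integral_chi_mul hω.le hl hβ γ L T (F := fun x => u x * k x)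
      (huc.mul hkc).aestronglyMeasurable hukL1).congr fun n => ?_
    exact integral_congr_ae (ae_of_all _ fun x => by ring)
  -- the cutoff-gradient terms vanish
  have hlimE : ∀ i : Fin L, Tendsto (fun n : ℕ => B i * ∫ x, u x * partialP i (chi P L n) x *
      partialP i u x * P.gibbsDensity L T x) atTop (𝓝 0) := by
    intro i
    rcases (hBnn i).eq_or_lt with hi | hi
    · rw [← hi]
      simp only [zero_mul]
      exact tendsto_const_nhds
    · have hF : Integrable fun x => u x * partialP i u x * P.gibbsDensity L T x :=
        integrable_mul_mul_gibbsDensity hω hl hβ γ L hT hu2 (hdu2 hi)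
      have h0 := tendsto_integral_partialP_chi_mul hω hl hβ γ L T i (F := fun x => u x * partialP i u x)
        (huc.mul (hduc i)).aestronglyMeasurable hF
      have h1 := h0.const_mul (B i)
      rw [mul_zero] at h1
      refine h1.congr fun n => ?_
      congr 1
      exact integral_congr_ae (ae_of_all _ fun x => by ring)
  -- the cut-off Dirichlet energies converge
  have hlimD : ∀ i : Fin L, Tendsto (fun n : ℕ => B i * ∫ x, chi P L n x * partialP i u x ^ 2 *
      P.gibbsDensity L T x) atTop (𝓝 (B i * ∫ x, partialP i u x ^ 2 * P.gibbsDensity L T x)) := by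
    intro i
    rcases (hBnn i).eq_or_lt with hi | hi
    · rw [← hi]
      simp only [zero_mul]
      exact tendsto_const_nhds
    · have hF : Integrable fun x => partialP i u x ^ 2 * P.gibbsDensity L T x :=
        integrable_sq_mul_gibbsDensity hω hl hβ γ L hT (hdu2 hi)
      exact (tendsto_integral_chi_mul hω.le hl hβ γ L T (F := fun x => partialP i u x ^ 2)
        ((hduc i).pow 2).aestronglyMeasurable hF).const_mul (B i)
  have hL : Tendsto (fun n : ℕ => (∫ x, chi P L n x * u x * k x * P.gibbsDensity L T x) -
      γ * T * ∑ i, B i * ∫ x, u x * partialP i (chi P L n) x * partialP i u x * P.gibbsDensity L T x)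
      atTop (𝓝 ((∫ x, u x * k x * P.gibbsDensity L T x) - γ * T * 0)) := by
    have hs := tendsto_finsetSum (Finset.univ : Finset (Fin L)) fun i _ => hlimE i
    rw [Finset.sum_const_zero] at hs
    exact hlim1.sub (hs.const_mul (γ * T))
  have hR : Tendsto (fun n : ℕ => γ * T * ∑ i, B i * ∫ x, chi P L n x * partialP i u x ^ 2 *
      P.gibbsDensity L T x) atTop
      (𝓝 (γ * T * ∑ i, B i * ∫ x, partialP i u x ^ 2 * P.gibbsDensity L T x)) :=
    (tendsto_finsetSum (Finset.univ : Finset (Fin L)) fun i _ => hlimD i).const_mul (γ * T)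
  have heq := tendsto_nhds_unique (hL.congr hlevel) hR
  rw [mul_zero, sub_zero] at heq
  exact heq

end DirichletLimit

/-! ## The registered stub -/

/-- **F3 — FAR-CONTACT FISHER SQUARE (fixed-`N`, size M–L; = card far-contact-fisher-square's first lemma in forward-field
form).**  For `L ≥ 2` and every classical mean-zero `C² ∩ L²(μ_T)` left forward field `g`:
`⟨g, p_{L−1}² − T⟩_{μ_T} = 2γT · ‖∂_{p_{L−1}} g‖²_{L²(μ_T)}` — the heat a spontaneous left-contact fluctuation sends into the FAR
bath is the Dirichlet energy the field spends at the far contact, doubled by reflection symmetry (Dirichlet identity, reflected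
field, conservation `γ(g + g∘R) = H − ⟨H⟩`, Gaussian projection). [folklore] -/
theorem stub_fisherSquare :
    ∀ (ω₂ lam β γ T : ℝ), 0 < ω₂ → 0 < lam → 0 < β → 0 < γ → 0 < T →
      ∀ (L : ℕ) (hL : 2 ≤ L) (g : PhaseSpace L → ℝ), ContDiff ℝ 2 g →
        MemLp g 2 ((pinnedChain ω₂ lam β γ).gibbsMeasure L T) →
        ∫ x, g x ∂((pinnedChain ω₂ lam β γ).gibbsMeasure L T) = 0 →
        (∀ x, (pinnedChain ω₂ lam β γ).generator L T T g x = -(kin L 0 x - T)) →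
        ∫ x, g x * (kin L (L - 1) x - T) ∂((pinnedChain ω₂ lam β γ).gibbsMeasure L T) =
          2 * γ * T * ∫ x, (partialP (⟨L - 1, by omega⟩ : Fin L) g x) ^ 2 ∂((pinnedChain ω₂ lam β γ).gibbsMeasure L T) := by
  intro ω₂ lam β γ T hω hl hβ hγ hT L hL g hgC hgL2 hg0 hgeq
  have hL0 : 0 < L := by omega
  have hL1 : L - 1 < L := by omega
  set P := pinnedChain ω₂ lam β γ with hP
  set μ := P.gibbsMeasure L T with hμ
  set H := P.hamiltonian L with hH
  set B := OscillatorChain.bathWeight L with hB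
  set i0 : Fin L := ⟨0, hL0⟩ with hi0
  set iR : Fin L := ⟨L - 1, hL1⟩ with hiR
  haveI : IsProbabilityMeasure μ := pinnedChain_isProbabilityMeasure_gibbsMeasure hω hl.le hβ.le γ L hT
  have hPγ : P.γ = γ := rfl
  have hV : ∀ r, P.V (-r) = P.V r := pinnedChain_V_neg ω₂ lam β γ
  have hR : MeasurePreserving (siteReflectionEquiv L) μ μ := measurePreserving_siteReflection_gibbsMeasure P hV L T
  have hrevR : Fin.rev iR = i0 := Fin.ext (by simp only [Fin.val_rev, hiR, hi0]; omega)
  have hrev0 : Fin.rev i0 = iR := Fin.ext (by simp only [Fin.val_rev, hiR, hi0])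
  -- the two bath weights
  have hBnn : ∀ i, 0 ≤ B i := bathWeight_nonneg L
  have hBi0 : 0 < B i0 := by
    simp only [hB, OscillatorChain.bathWeight, hi0, if_true]
    split_ifs <;> norm_num
  have hBiR : 0 < B iR := by
    simp only [hB, OscillatorChain.bathWeight, hiR, if_true]
    split_ifs <;> norm_num
  -- regularity and square integrability of `g`, `H`, `k_0`
  have hgd : Differentiable ℝ g := hgC.differentiable two_ne_zero
  have hHs : ContDiff ℝ ∞ H :=
    P.contDiff_hamiltonian (pinnedChain_contDiff_U ω₂ lam β γ) (pinnedChain_contDiff_V ω₂ lam β γ) L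
  have hH2 : ContDiff ℝ 2 H := hHs.of_le (by norm_cast)
  have hH0 : ∀ x, 0 ≤ H x := fun x => pinnedChain_hamiltonian_nonneg hω.le hl.le hβ.le γ L x
  have hHL2 : MemLp H 2 μ :=
    pinnedChain_memLp_two_of_abs_le hω hl.le hβ.le γ L hT hHs.continuous (C := 1) (k := 1) fun x => by
      rw [abs_of_nonneg (hH0 x), pow_one, one_mul]
      linarith [hH0 x]
  have hk0L2 : MemLp (fun x => kin L 0 x - T) 2 μ :=
    ((pinnedChain_memLp_two_snd_sq hω hl.le hβ.le γ L hT ⟨0, hL0⟩).sub (memLp_const T)).ae_eq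
      (ae_of_all _ fun x => by simp [kin_eq_sq hL0])
  have hk0c : Continuous fun x => kin L 0 x - T := (continuous_kin 0).sub continuous_const
  -- the forward pair `(g, k_0)` in operator form, and finite entropy production at the two contacts
  have hpg : ∀ x, 1 * liouvilleOp P L g x + γ * bathOp L B T g x = -(kin L 0 x - T) := fun x => by
    rw [one_mul, ← hgeq x, generator_eq_liouvilleOp_add]; rfl
  have haL2 : MemLp (partialP iR g) 2 μ := memLp_partialP hω hl.le hβ.le γ L hT B hBnn 1 hγ hgC hgL2 hk0L2 hpg hBiR
  have ha0L2 : MemLp (partialP i0 g) 2 μ := memLp_partialP hω hl.le hβ.le γ L hT B hBnn 1 hγ hgC hgL2 hk0L2 hpg hBi0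
  -- ## (R) the reflected field is the right bath's forward field
  set gR : PhaseSpace L → ℝ := g ∘ siteReflection L with hgR
  have hgRC : ContDiff ℝ 2 gR := hgC.comp contDiff_siteReflection
  have hgRd : Differentiable ℝ gR := hgRC.differentiable two_ne_zero
  have hgRL2 : MemLp gR 2 μ := hgL2.comp_measurePreserving hR
  have hgR0 : ∫ x, gR x ∂μ = 0 := by
    have h := hR.integral_comp' (f := siteReflectionEquiv L) g
    simp only [siteReflectionEquiv_apply] at h
    rw [hg0] at h
    simpa only [hgR, Function.comp_apply] using h
  have hgReq : ∀ x, P.generator L T T gR x = -(kin L (L - 1) x - T) := by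
    intro x
    rw [hgR, P.generator_comp_siteReflection hV L T T g x, hgeq, kin_zero_siteReflection hL0]
  -- ## energy conservation: `u = γ (g + g∘R) − (H − ⟨H⟩)` is a mean-zero `C² ∩ L²` solution of `L u = 0`
  set cH : ℝ := ∫ x, H x ∂μ with hcH
  have hC1 : ContDiff ℝ 2 (fun y => γ * (g + gR) y) := contDiff_const.mul (hgC.add hgRC)
  have hC2 : ContDiff ℝ 2 (fun y => (-1 : ℝ) * (H y - cH)) := contDiff_const.mul (hH2.sub contDiff_const)
  set u : PhaseSpace L → ℝ := (fun y => γ * (g + gR) y) + fun y => (-1 : ℝ) * (H y - cH) with hu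
  have huC : ContDiff ℝ 2 u := hC1.add hC2
  have huL2 : MemLp u 2 μ := ((hgL2.add hgRL2).const_mul γ).add ((hHL2.sub (memLp_const cH)).const_mul (-1))
  -- linearity of `L_{T,T} = X_H + γ S` on `C²`
  have gen_add : ∀ {f₁ f₂ : PhaseSpace L → ℝ}, ContDiff ℝ 2 f₁ → ContDiff ℝ 2 f₂ → ∀ x,
      P.generator L T T (f₁ + f₂) x = P.generator L T T f₁ x + P.generator L T T f₂ x := by
    intro f₁ f₂ h₁ h₂ x
    rw [generator_eq_liouvilleOp_add, generator_eq_liouvilleOp_add, generator_eq_liouvilleOp_add,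
      liouvilleOp_add' P (h₁.differentiable two_ne_zero) (h₂.differentiable two_ne_zero), bathOp_add' h₁ h₂]
    ring
  have gen_const_mul : ∀ (a : ℝ) (f₁ : PhaseSpace L → ℝ) (x : PhaseSpace L),
      P.generator L T T (fun y => a * f₁ y) x = a * P.generator L T T f₁ x := by
    intro a f₁ x
    rw [generator_eq_liouvilleOp_add, generator_eq_liouvilleOp_add, liouvilleOp_const_mul, bathOp_const_mul]
    ring
  have hu_gen : ∀ x, P.generator L T T u x = 0 := by
    intro x
    have e1 : P.generator L T T u x = P.generator L T T (fun y => γ * (g + gR) y) x +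
        P.generator L T T (fun y => (-1 : ℝ) * (H y - cH)) x := gen_add hC1 hC2 x
    have e2 : P.generator L T T (fun y => γ * (g + gR) y) x = γ * P.generator L T T (g + gR) x :=
      gen_const_mul γ (g + gR) x
    have e3 : P.generator L T T (g + gR) x = P.generator L T T g x + P.generator L T T gR x := gen_add hgC hgRC x
    have e4 : P.generator L T T (fun y => (-1 : ℝ) * (H y - cH)) x =
        (-1 : ℝ) * P.generator L T T (fun y => H y - cH) x := gen_const_mul (-1) _ x
    have e5 : P.generator L T T (fun y => H y - cH) x = P.generator L T T H x := generator_sub_const P T T H cH x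
    have e6 : P.generator L T T H x = -(γ * ((kin L 0 x - T) + (kin L (L - 1) x - T))) := by
      rw [generator_eq_liouvilleOp_add, liouvilleOp_hamiltonian, bathOp_bathWeight_hamiltonian P hL0, hPγ]
      ring
    rw [e1, e2, e3, e4, e5, e6, hgeq x, hgReq x]
    ring
  have hu_pde : ∀ x, 1 * liouvilleOp P L u x + γ * bathOp L B T u x = 0 := fun x => by
    rw [one_mul, ← hu_gen x, generator_eq_liouvilleOp_add]; rfl
  have hgi : Integrable g μ := hgL2.integrable one_le_two
  have hgRi : Integrable gR μ := hgRL2.integrable one_le_two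
  have hHi : Integrable H μ := hHL2.integrable one_le_two
  have hu_mean : ∫ x, u x ∂μ = 0 := by
    have i1 : Integrable (fun y => γ * (g y + gR y)) μ := (hgi.add hgRi).const_mul γ
    have i2 : Integrable (fun y => (-1 : ℝ) * (H y - cH)) μ := (hHi.sub (integrable_const cH)).const_mul (-1)
    simp only [hu, Pi.add_apply]
    rw [integral_add i1 i2, integral_const_mul, integral_const_mul, integral_add hgi hgRi,
      integral_sub hHi (integrable_const cH), integral_const, hg0, hgR0]
    simp [hcH]
  have hu0 : ∀ x, u x = 0 := fun x =>
    eq_zero_of_liouville_pinnedChain hω hl.le hβ.le γ hL0 hT B hBnn hBi0 one_ne_zero hγ huC huL2 hu_pde hu_mean x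
  -- ## differentiate the conservation law along `p_{L−1}`: `γ (a + b) = p_{L−1}`
  have hfun : (fun y => γ * (g y + gR y)) = fun y => H y - cH := by
    funext y
    have := hu0 y
    simp only [hu, Pi.add_apply] at this
    linarith
  have hgrad : ∀ x, γ * (partialP iR g x + partialP i0 g (siteReflection L x)) = x.2 iR := by
    intro x
    have e1 : partialP iR (fun y => γ * (g y + gR y)) x = γ * partialP iR (fun y => g y + gR y) x :=
      partialP_const_mul γ _ iR x
    have e2 : partialP iR (fun y => g y + gR y) x = partialP iR g x + partialP iR gR x :=
      partialP_add hgd hgRd iR x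
    have e3 : partialP iR gR x = partialP i0 g (siteReflection L x) := by
      rw [hgR, partialP_comp_siteReflection, hrevR]
    have e4 : partialP iR (fun y => H y - cH) x = x.2 iR := by rw [partialP_sub_const', P.partialP_hamiltonian]
    have key : partialP iR (fun y => γ * (g y + gR y)) x = partialP iR (fun y => H y - cH) x := by rw [hfun]
    rw [e1, e2, e3, e4] at key
    exact key
  -- ## (P) Gaussian projections and the change of variables `R`
  have hbL2 : MemLp (fun x => partialP i0 g (siteReflection L x)) 2 μ := ha0L2.comp_measurePreserving hR
  have hBf : ∫ x, g x * (kin L (L - 1) x - T) ∂μ = T * ∫ x, partialP iR g x * x.2 iR ∂μ := by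
    rw [← integral_mul_sq_sub_gibbsMeasure hω hl.le hβ.le γ L hT iR hgd hgL2 haL2]
    exact integral_congr_ae (ae_of_all _ fun x => by dsimp only; rw [kin_eq_sq hL1])
  have hA : ∫ x, g x * (kin L 0 x - T) ∂μ = T * ∫ x, partialP i0 g x * x.2 i0 ∂μ := by
    rw [← integral_mul_sq_sub_gibbsMeasure hω hl.le hβ.le γ L hT i0 hgd hgL2 ha0L2]
    exact integral_congr_ae (ae_of_all _ fun x => by dsimp only; rw [kin_eq_sq hL0])
  have hbp : ∫ x, partialP i0 g (siteReflection L x) * x.2 iR ∂μ = ∫ x, partialP i0 g x * x.2 i0 ∂μ := by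
    rw [← hR.integral_comp' (f := siteReflectionEquiv L) (fun y => partialP i0 g y * y.2 i0)]
    refine integral_congr_ae (ae_of_all _ fun x => ?_)
    simp only [siteReflectionEquiv_apply, siteReflection_snd, hrev0]
  have hbb : ∫ x, partialP i0 g (siteReflection L x) ^ 2 ∂μ = ∫ x, partialP i0 g x ^ 2 ∂μ := by
    simpa only [siteReflectionEquiv_apply] using
      hR.integral_comp' (f := siteReflectionEquiv L) (fun y => partialP i0 g y ^ 2)
  -- pair `γ (a + b) = p_{L−1}` with `a` and with `b`
  have iaa : Integrable (fun x => partialP iR g x ^ 2) μ := haL2.integrable_sq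
  have iab : Integrable (fun x => partialP iR g x * partialP i0 g (siteReflection L x)) μ := haL2.integrable_mul hbL2
  have ibb : Integrable (fun x => partialP i0 g (siteReflection L x) ^ 2) μ := hbL2.integrable_sq
  have hI1 : ∫ x, partialP iR g x * x.2 iR ∂μ =
      γ * (∫ x, partialP iR g x ^ 2 ∂μ) + γ * ∫ x, partialP iR g x * partialP i0 g (siteReflection L x) ∂μ := by
    rw [← integral_const_mul, ← integral_const_mul, ← integral_add (iaa.const_mul γ) (iab.const_mul γ)]
    refine integral_congr_ae (ae_of_all _ fun x => ?_)
    dsimp only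
    rw [← hgrad x]
    ring
  have hI2 : ∫ x, partialP i0 g (siteReflection L x) * x.2 iR ∂μ =
      γ * (∫ x, partialP iR g x * partialP i0 g (siteReflection L x) ∂μ) +
        γ * ∫ x, partialP i0 g (siteReflection L x) ^ 2 ∂μ := by
    rw [← integral_const_mul, ← integral_const_mul, ← integral_add (iab.const_mul γ) (ibb.const_mul γ)]
    refine integral_congr_ae (ae_of_all _ fun x => ?_)
    dsimp only
    rw [← hgrad x]
    ring
  -- ## (D) the Dirichlet identity
  have hDρ := integral_mul_source_eq_dirichlet' hω hl.le hβ.le hγ hT hgC hgL2 hk0c hk0L2 hgeq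
  rw [sum_bathWeight_mul' (fun i => ∫ x, partialP i g x ^ 2 * P.gibbsDensity L T x) (b₀ := i0) (b₁ := iR)
    rfl rfl] at hDρ
  have hD : ∫ x, g x * (kin L 0 x - T) ∂μ = γ * T * ((∫ x, partialP i0 g x ^ 2 ∂μ) + ∫ x, partialP iR g x ^ 2 ∂μ) := by
    rw [P.integral_gibbsMeasure, P.integral_gibbsMeasure, P.integral_gibbsMeasure, hDρ]
    ring
  -- ## assembly
  have final : ∫ x, g x * (kin L (L - 1) x - T) ∂μ = 2 * γ * T * ∫ x, partialP iR g x ^ 2 ∂μ := by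
    linear_combination hBf + T * hI1 + hD - hA + T * hbp - T * γ * hbb - T * hI2
  exact final

end Summit.AtomisticToContinuum.FouriersLaw.Cruxes.ConductanceLowerBound.ForecastSensitivity

end
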